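import Summits.QuantumFields.YangMills.Theorems.LangevinControlUVFemtoCurvatureTwoPointCDefsSplit

/-!
# Route `LangevinControlUV`, crux `FemtoCurvatureTwoPointC` (stmt-QuantumFields-16204): vocabulary of line `Sketch`, IV — the explicit two-loop form on femto boxes

Part IV of the route-posited statements of the skeleton `Cruxes/FemtoCurvatureTwoPointC/Lines/Sketch.lean` (continuation lead
`prover-line-stmt-QuantumFields-16204-c3-0`, cycle 5; parts I–III are `…CDefs`, `…CDefsProfiles`, `…CDefsSplit`, same namespace:
NOTHING here is asserted). `AsymptoticScalingBigAt r` is to `AFProfilesBigAt r` (part III) what the cycle-2 `AsymptoticScalingAt r`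
is to `AFCouplingAt r`: the SAME matching clauses (transverse lower / transverse upper / longitudinal upper / variance ceiling on
window boxes `L ≥ 8`) with the existential admissible coupling `u` INSTANTIATED by the explicit two-loop asymptotic-freedom coupling
`u = twoLoopCoupling κ c₀ b₀ q` (`…CDefs`), whose admissibility (`stub_twoLoopAdmissible`, p124718), in-window comparability and
dyadic step law (`stub_twoLoopStepLaw`, p124768) and bare size (`twoLoopCoupling_bareSize`, p128233) are landed calculus; hence
`AsymptoticScalingBigAt r → AFProfilesBigAt r` (companion file `…CScalingBigReduction`). It is offered to the planner as the
CONCRETE (∃-over-parameters only) form of the promoted femto-engine statement — "two-sided asymptotic scaling of the diagonal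
curvature profiles in two-loop units on femto boxes" — stronger than `AFProfilesBigAt` (two-sidedness along the window pins
`κ/b₀` and `b₁/b₀²`, cycle-2 notes §5) but the standard physics formulation.
-/

set_option autoImplicit false

noncomputable section

open Filter Topology MeasureTheory
open Literature.MathematicalPhysics.QuantumFieldTheory

namespace Summit.QuantumFields.YangMills.Theorems.FemtoCurvatureTwoPointC

/-- **Asymptotic scaling of the diagonal profiles on femto boxes at fixed data `(G, r)` (OPEN; crux-sized).** There are two-loop
parameters `κ > 0`, `c₀`, `b₀ > 0`, `q ≥ 0`, a window height `u₀ > 0` with `u₀·ψ_q(2b₀ log 2) < 1`, a threshold `β₀` and constants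
`0 < c`, `C` such that, `u` denoting the explicit two-loop coupling (`T = twoLoopT κ c₀ b₀ q`, `u L β = (twoLoopPsi q (T L β))⁻¹`,
written out), on every BOX `L ≥ 8` in the `u`-window at `β ≥ β₀` (every sub-box `8 ≤ M ≤ L` has `u M β ≤ u₀`): TRANSVERSE LOWER
`c·u(8n,β)² ≤ n⁸ f_L(n)` (`1 ≤ n`, `8n ≤ L`), TRANSVERSE UPPER `s⁸ f_L(s) ≤ C·u(max 8 (min L (8s)),β)²` and LONGITUDINAL UPPER
`s⁸ |g_L(s)| ≤ C·u(…)²` (`1 ≤ s`, `2s ≤ L`), VARIANCE CEILING `Var_{L,β}(P_0^{01}) ≤ C·u(8,β)²` — with `f_L(s) = Cov_{L,β}(P_0^{01},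
P_{se₂}^{01})`, `g_L(s) = Cov_{L,β}(P_0^{01},P_{se₀}^{01})`. Same `P`, `E` equations as everywhere in this vocabulary. -/
def AsymptoticScalingBigAt {G : Type} [Group G] [TopologicalSpace G] [IsTopologicalGroup G] [CompactSpace G]
    [MeasurableSpace G] [BorelSpace G] (r : LatticeRep G) : Prop :=
  ∃ (κ c₀ b₀ q u₀ β₀ c C : ℝ),
    0 < κ ∧ 0 < b₀ ∧ 0 ≤ q ∧ 0 < u₀ ∧
    u₀ * (1 + 2 * b₀ * Real.log 2 + q * Real.log (2 * b₀ * Real.log 2 + Real.exp 1)) < 1 ∧ 0 < c ∧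
    ∀ (T u : ℕ → ℝ → ℝ),
      (T = fun (L : ℕ) (β : ℝ) => max (κ * β + c₀) 1 - q * Real.log (max (κ * β + c₀) 1 + q) -
          2 * b₀ * Real.log ((L : ℝ) / 8)) →
      (u = fun (L : ℕ) (β : ℝ) => ((1 + q) * Real.exp (min (T L β) 0) + max (T L β) 0 +
          q * (Real.log (max (T L β) 0 + Real.exp 1) - 1))⁻¹) →
      (∀ (L : ℕ) [NeZero L] (β : ℝ) (n : ℕ), β₀ ≤ β → 1 ≤ n → 8 * n ≤ L →
          (∀ M : ℕ, 8 ≤ M → M ≤ L → u M β ≤ u₀) →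
          ∀ (P : (Fin 4 → ZMod L) → Fin 4 → Fin 4 → GaugeConfig 4 L G → ℝ)
            (E : (GaugeConfig 4 L G → ℝ) → ℝ),
            (P = fun x i j U => (r.N : ℝ) - (r.ρ (plaquetteHolonomy U x i j)).trace.re) →
            (E = fun F => wilsonExpectation r.ρ β F) →
            c * u (8 * n) β ^ 2 ≤
              (n : ℝ) ^ 8 * (E (fun U => P 0 0 1 U * P (Pi.single (2 : Fin 4) ((n : ℕ) : ZMod L)) 0 1 U)
                - E (P 0 0 1) * E (P (Pi.single (2 : Fin 4) ((n : ℕ) : ZMod L)) 0 1))) ∧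
      (∀ (L : ℕ) [NeZero L] (β : ℝ) (s : ℕ), β₀ ≤ β → 8 ≤ L → 1 ≤ s → 2 * s ≤ L →
          (∀ M : ℕ, 8 ≤ M → M ≤ L → u M β ≤ u₀) →
          ∀ (P : (Fin 4 → ZMod L) → Fin 4 → Fin 4 → GaugeConfig 4 L G → ℝ)
            (E : (GaugeConfig 4 L G → ℝ) → ℝ),
            (P = fun x i j U => (r.N : ℝ) - (r.ρ (plaquetteHolonomy U x i j)).trace.re) →
            (E = fun F => wilsonExpectation r.ρ β F) →
            (s : ℝ) ^ 8 * (E (fun U => P 0 0 1 U * P (Pi.single (2 : Fin 4) ((s : ℕ) : ZMod L)) 0 1 U)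
                - E (P 0 0 1) * E (P (Pi.single (2 : Fin 4) ((s : ℕ) : ZMod L)) 0 1)) ≤
              C * u (max 8 (min L (8 * s))) β ^ 2) ∧
      (∀ (L : ℕ) [NeZero L] (β : ℝ) (s : ℕ), β₀ ≤ β → 8 ≤ L → 1 ≤ s → 2 * s ≤ L →
          (∀ M : ℕ, 8 ≤ M → M ≤ L → u M β ≤ u₀) →
          ∀ (P : (Fin 4 → ZMod L) → Fin 4 → Fin 4 → GaugeConfig 4 L G → ℝ)
            (E : (GaugeConfig 4 L G → ℝ) → ℝ),
            (P = fun x i j U => (r.N : ℝ) - (r.ρ (plaquetteHolonomy U x i j)).trace.re) →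
            (E = fun F => wilsonExpectation r.ρ β F) →
            (s : ℝ) ^ 8 * |E (fun U => P 0 0 1 U * P (Pi.single (0 : Fin 4) ((s : ℕ) : ZMod L)) 0 1 U)
                - E (P 0 0 1) * E (P (Pi.single (0 : Fin 4) ((s : ℕ) : ZMod L)) 0 1)| ≤
              C * u (max 8 (min L (8 * s))) β ^ 2) ∧
      (∀ (L : ℕ) [NeZero L] (β : ℝ), β₀ ≤ β → 8 ≤ L → (∀ M : ℕ, 8 ≤ M → M ≤ L → u M β ≤ u₀) →
          ∀ (P : (Fin 4 → ZMod L) → Fin 4 → Fin 4 → GaugeConfig 4 L G → ℝ)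
            (E : (GaugeConfig 4 L G → ℝ) → ℝ),
            (P = fun x i j U => (r.N : ℝ) - (r.ρ (plaquetteHolonomy U x i j)).trace.re) →
            (E = fun F => wilsonExpectation r.ρ β F) →
            E (fun U => P 0 0 1 U * P 0 0 1 U) - E (P 0 0 1) * E (P 0 0 1) ≤ C * u 8 β ^ 2)

/-- **Asymptotic scaling on femto boxes (universal closure)**: for every compact simple `G` (any Borel structure) and faithful
unitary `r`, `AsymptoticScalingBigAt r`. OPEN; a sufficient, explicit form of `AFProfilesBig`
(`afProfilesBig_of_asymptoticScalingBig`, companion file). -/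
def AsymptoticScalingBig : Prop :=
  ∀ (G : Type) [Group G] [TopologicalSpace G] [IsTopologicalGroup G] [CompactSpace G]
    [MeasurableSpace G] [BorelSpace G], IsCompactSimpleLieGroup G →
    ∀ r : LatticeRep G, AsymptoticScalingBigAt r

/-- `AsymptoticScalingBig` unfolded (definitional; registered sub-goal linking the vocabulary file to the crux item). -/
theorem asymptoticScalingBig_iff :
    AsymptoticScalingBig ↔
      ∀ (G : Type) [Group G] [TopologicalSpace G] [IsTopologicalGroup G] [CompactSpace G]
        [MeasurableSpace G] [BorelSpace G], IsCompactSimpleLieGroup G →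
        ∀ r : LatticeRep G, AsymptoticScalingBigAt r :=
  Iff.rfl

end Summit.QuantumFields.YangMills.Theorems.FemtoCurvatureTwoPointC

end
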